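import Literature.NumberTheory.Rogawski1990.UnitFundamentalLemmaInertResiduallyRegular   -- ★ p839927: rr template (normalised torus measures on the product, evaluation kit)
import Literature.NumberTheory.Automorphic.UnitOrbitalIntegralSplitTorusNonsplit           -- ★ C2 (F0P3b-p01): the `G`-side template and its import closure
import Literature.NumberTheory.Automorphic.UnitaryGroupTorusOrbitalDescentNonsplitTwo    -- ★ B′: the `K T N` data of `U(Φ₂)(L⁺_v)`, rank-one twist at `N = 2`
import Literature.NumberTheory.Automorphic.TorusOrbitalDescentProdCompactFactor       -- ★ C′₁: the product plumbing
import Literature.MeasureTheory.Group.InvariantQuotientProdNormalized                 -- ★ `isClosed_coe_prod`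
import HarnessLib

/-!
# The unit orbital integral of the endoscopic group `H_v = U(Φ₂)(L⁺_v) × U(Φ₁)(L⁺_v)` at a SPLIT-TORUS class, non-split place:
# `Φ_H(⟦γ_H⟧, 1_{K_H}) = χ⁻(b − 1)⁻¹ = (√‖d₀⁻¹d₁ − 1‖)⁻¹`
(Rogawski (1990), §4.9 Prop. 4.9.1 (b), (4.9.2) p. 55 «`Φ(γ, 1_K) = |D(γ)|⁻¹(1_K)^{(B)}(γ)`» on `H = U(2) × U(1)` (p. 98: treated uniformly with `U(3)`); §4.3
(4.3.1) p. 43 compatible measures; Gelbart (1975) Thm. 9.22 (iii); Deitmar–Echterhoff (2014) Thm. 1.5.3)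

Topic `NumberTheory/Automorphic`; namespace `Literature.NumberTheory.Automorphic.UnitaryGroup`.  KERNEL mathematics only: theorems, no definition, no named
fact, no instance, no notation, no `sorry`.  Cell `pub/hodgecm-mathlib`, programme P3a, road «D-N7-inert», brick «(L8b)-H» FILE C′₂ = the `H`-SIDE VALUE of the
Levi ∕ split-torus clause (F0P3b-p01 (g6) offer 03:05:55Z; LEAD F0P3a-plan (g9) T8-28 (2) ∕ T8-33); it discharges the binder `hΦH` of ★ F0P3b-p01 FILE F
`Rogawski1990/UnitFundamentalLemmaInertLevi.stableOrbitalIntegralRel_indicator_eq_finsum_delta_of_levi_of_nonsplit` in ITS spelling.  HC_CM is proved only modulo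
the printed citations (2 remaining named inputs hLiu418, h413) until rung 0 closes; this file discharges no named fact.

THE ASSEMBLY (every input ★; the architecture of ★ C2 with `Ψ` = the re-spelling `H_v ≃ U(Φ₂)(L⁺_v) × U(Φ₁)(L⁺_v)` of the first factor).  `γ_H = (γ₂, γ₁) ∈ K_H = K₂ × K₁`,
`γ₂ = diag(d₀, d₁) ∈ T₂(L⁺_v)` REGULAR (`b − 1 = d₀⁻¹d₁ − 1` a unit), `K₁ = U(Φ₁)(L⁺_v)` (non-split `v`; binder `hK₁`), `mH` CANONICAL at the class of `γ_H`
(★ `OrbitalMeasureFamily.IsCanonical`, `νH(K_H) = 1`).  (1) a normalised torus measure `t_Z` on `Z(γ_H)` (★ `exists_isHaarMeasure_compactCore_centralizer_prod_eq_one` over ★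
`compactCore_centralizer_local_facts_of_isRegularElt` at `N = 2, 1`), so `Φ_H(⟦γ_H⟧, 1_{K_H}) = ∫⁻_{H_v ⧸ Z} 1_{K_H}(y γ_H y⁻¹) d(νH ∕ t_Z)` (★
`IsCanonical.classOrbitalIntegral_mk_eq_orbitalIntegral`); `compactCore Z(γ_H) ⊆ K_H` (compact subgroups of `Z(γ₂)` are integral at the one place `w ∣ v`: ★ C1
`subgroup_le_glInt_of_isCompact_of_le_centralizer_diagonal` + ★ C′₁ `compactCore_subset_preimage_prod`).  (2) on `G := U(Φ₂)(L⁺_v) × U(Φ₁)(L⁺_v)` Gelbart's data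
`T := T₂ × U`, `N := N₂ × 1`, `B := B₂ × U`, `K := K₂ × K₁` (★ A″∕B′∕C′₁: closedness, `T × N ≃ₜ B`, good position, `G = K B`, abelian `T`, `N`, the twist `J_H = χ⁻(b − 1)⁻¹` of ★ A′
on `N₂ × 1`) ⇒ the Iwasawa form of `Ψ_*νH ∕ Ψ_*t_Z` (★ `exists_measure_quotient_eq_smul_map`).  (3) ★ F0P3b-p01 FILE B §2 `lintegral_descConj_centralizer_indicator_eq_of_mulEquiv`
along `Ψ` (`Ψ Z(γ_H) = T`: ★ C1 `mem_torusU_iff_mem_centralizer_of_isUnit_sub` + `U(Φ₁)` abelian): the Iwasawa constant CANCELS, value `J_H · 1_K(Ψ γ_H) = J_H`;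
(4) `J_H = (√‖b − 1‖)⁻¹` (★ B′ `twistModule_cmLocal_two_eq`).  NOT here: the `G`-side (★ C2), `Δ‴` (★ D), the clause (★ F).

References: [Rogawski1990] J. D. Rogawski, *Automorphic Representations of Unitary Groups in Three Variables*, Ann. of Math. Stud. 123 (1990), §4.9 Prop. 4.9.1 (b),
(4.9.2) p. 55; §4.3 (4.3.1) p. 43; §4.13 p. 70; p. 98 · [Gelbart1975] S. Gelbart, *Automorphic Forms on Adele Groups*, Ann. of Math. Stud. 83, Thm. 9.22 (iii) ·
[DeitmarEchterhoff2014] A. Deitmar, S. Echterhoff, *Principles of Harmonic Analysis*, 2nd ed., Thm. 1.5.3. -/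

set_option autoImplicit false

noncomputable section

open MeasureTheory Measure Set Filter Topology NumberField IsDedekindDomain
open Literature.MeasureTheory.Group
open scoped ENNReal NNReal Matrix MatrixGroups

namespace Literature.NumberTheory.Automorphic.UnitaryGroup

open Literature.NumberTheory.Rogawski1990 (IsRegularElt)
open Literature.NumberTheory.Automorphic Literature.NumberTheory.Automorphic.TorusDescentProd
open Literature.NumberTheory.Automorphic.UnitaryGroup.HeisRing Literature.NumberTheory.Automorphic.UnitaryGroup.LineRing

/-- `U(Φ₁)(L⁺_v) ⊂ GL₁(∏_{w∣v} L_w)` is abelian (`1 × 1` matrices). [cite: Rogawski1990, §4.9 p. 55] -/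
theorem mul_comm_cmDatum_local_one (L : Type) [Field L] [NumberField L] [IsCMField L] (v : HeightOneSpectrum (𝓞 ↥(maximalRealSubfield L)))
    (x y : (cmDatum L 1 (Matrix.of fun i j : Fin 1 => if i.val + j.val + 1 = 1 then (1 : L) else 0)).Local v) : x * y = y * x := by
  have h1 : ((x * y : (cmDatum L 1 (Matrix.of fun i j : Fin 1 => if i.val + j.val + 1 = 1 then (1 : L) else 0)).Local v).val : GL (Fin 1) (LocalRing L v)) = x.val * y.val := rfl
  have h2 : ((y * x : (cmDatum L 1 (Matrix.of fun i j : Fin 1 => if i.val + j.val + 1 = 1 then (1 : L) else 0)).Local v).val : GL (Fin 1) (LocalRing L v)) = y.val * x.val := rfl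
  refine Subtype.ext (Matrix.GeneralLinearGroup.ext fun i j => ?_)
  obtain rfl : i = 0 := Subsingleton.elim _ _
  obtain rfl : j = 0 := Subsingleton.elim _ _
  rw [h1, h2, Units.val_mul, Units.val_mul, Matrix.mul_apply, Matrix.mul_apply, Fin.sum_univ_one, Fin.sum_univ_one]
  exact mul_comm _ _

set_option maxHeartbeats 1600000 in
set_option synthInstance.maxHeartbeats 400000 in
-- instance-term unification on the CM local carriers (two spellings of `U(Φ₂)(L⁺_v)`), as in ★ `UnitOrbitalIntegralSplitTorusNonsplit` (C2)
/-- **THE UNIT ORBITAL INTEGRAL OF `H_v = U(Φ₂)(L⁺_v) × U(Φ₁)(L⁺_v)` AT A REGULAR SPLIT-TORUS CLASS, NON-SPLIT PLACE** — the `H`-side of [Rogawski1990]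
Prop. 4.9.1 (b) in the Levi case, (4.9.2) «`Φ(γ, 1_K) = |D(γ)|⁻¹(1_K)^{(B)}(γ)`», with the compatible measures of §4.3: at a finite place `v` of `L⁺` with a place
`w ∣ v` fixed by `c̄` (non-split), for a CANONICAL orbital measure family `mH` on `H_v` (canonical at the class of `γ_H` for its predicate `P_H`; Haar `νH`, right
invariant, `νH(K₂ × K₁) = 1`), `K₁ = U(Φ₁)(L⁺_v)` (`hK₁`), and `γ_H ∈ K₂ × K₁` whose `U(Φ₂)`-component is a REGULAR DIAGONAL `diag(d₀, d₁)` (`b − 1 = d₀⁻¹d₁ − 1` a unit,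
separable characteristic polynomial):
**`Φ_H(⟦γ_H⟧, 1_{K₂ × K₁}) = (√‖d₀⁻¹d₁ − 1‖)⁻¹`**, `‖·‖ = unitModulusChar (LocalRing L v) = ∏_{w∣v} |·|_w` — the binder `hΦH` of ★ F0P3b-p01's Levi clause, in its spelling.
[cite: Rogawski1990, §4.9 Prop. 4.9.1 (b), (4.9.2) p. 55; §4.3 (4.3.1) p. 43; §4.13 p. 70] [cite: Gelbart1975, Thm. 9.22 (iii)] [cite: DeitmarEchterhoff2014, Thm. 1.5.3] -/
theorem classOrbitalIntegral_indicator_prod_eq_inv_sqrt_of_torus_regular_of_nonsplit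
    (L : Type) [Field L] [NumberField L] [IsCMField L] {v : HeightOneSpectrum (𝓞 ↥(maximalRealSubfield L))}
    (w : PlacesOver L v) (hw : IsCMField.complexConj L • w.1 = w.1)
    [MeasurableSpace ((cmDatum L 2 (Matrix.of fun i j : Fin 2 => if i.val + j.val + 1 = 2 then (1 : L) else 0)).Local v ×
      (cmDatum L 1 (Matrix.of fun i j : Fin 1 => if i.val + j.val + 1 = 1 then (1 : L) else 0)).Local v)]
    [BorelSpace ((cmDatum L 2 (Matrix.of fun i j : Fin 2 => if i.val + j.val + 1 = 2 then (1 : L) else 0)).Local v ×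
      (cmDatum L 1 (Matrix.of fun i j : Fin 1 => if i.val + j.val + 1 = 1 then (1 : L) else 0)).Local v)]
    [∀ a : (cmDatum L 2 (Matrix.of fun i j : Fin 2 => if i.val + j.val + 1 = 2 then (1 : L) else 0)).Local v ×
      (cmDatum L 1 (Matrix.of fun i j : Fin 1 => if i.val + j.val + 1 = 1 then (1 : L) else 0)).Local v,
      MeasurableSpace (((cmDatum L 2 (Matrix.of fun i j : Fin 2 => if i.val + j.val + 1 = 2 then (1 : L) else 0)).Local v ×
      (cmDatum L 1 (Matrix.of fun i j : Fin 1 => if i.val + j.val + 1 = 1 then (1 : L) else 0)).Local v) ⧸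
        Subgroup.centralizer ({a} : Set ((cmDatum L 2 (Matrix.of fun i j : Fin 2 => if i.val + j.val + 1 = 2 then (1 : L) else 0)).Local v ×
      (cmDatum L 1 (Matrix.of fun i j : Fin 1 => if i.val + j.val + 1 = 1 then (1 : L) else 0)).Local v)))]
    [∀ a : (cmDatum L 2 (Matrix.of fun i j : Fin 2 => if i.val + j.val + 1 = 2 then (1 : L) else 0)).Local v ×
      (cmDatum L 1 (Matrix.of fun i j : Fin 1 => if i.val + j.val + 1 = 1 then (1 : L) else 0)).Local v,
      BorelSpace (((cmDatum L 2 (Matrix.of fun i j : Fin 2 => if i.val + j.val + 1 = 2 then (1 : L) else 0)).Local v ×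
      (cmDatum L 1 (Matrix.of fun i j : Fin 1 => if i.val + j.val + 1 = 1 then (1 : L) else 0)).Local v) ⧸
        Subgroup.centralizer ({a} : Set ((cmDatum L 2 (Matrix.of fun i j : Fin 2 => if i.val + j.val + 1 = 2 then (1 : L) else 0)).Local v ×
      (cmDatum L 1 (Matrix.of fun i j : Fin 1 => if i.val + j.val + 1 = 1 then (1 : L) else 0)).Local v)))]
    (νH : Measure ((cmDatum L 2 (Matrix.of fun i j : Fin 2 => if i.val + j.val + 1 = 2 then (1 : L) else 0)).Local v ×
      (cmDatum L 1 (Matrix.of fun i j : Fin 1 => if i.val + j.val + 1 = 1 then (1 : L) else 0)).Local v)) [νH.IsHaarMeasure] [νH.IsMulRightInvariant]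
    {P_H : (cmDatum L 2 (Matrix.of fun i j : Fin 2 => if i.val + j.val + 1 = 2 then (1 : L) else 0)).Local v ×
      (cmDatum L 1 (Matrix.of fun i j : Fin 1 => if i.val + j.val + 1 = 1 then (1 : L) else 0)).Local v → Prop}
    {mH : OrbitalMeasureFamily ((cmDatum L 2 (Matrix.of fun i j : Fin 2 => if i.val + j.val + 1 = 2 then (1 : L) else 0)).Local v ×
      (cmDatum L 1 (Matrix.of fun i j : Fin 1 => if i.val + j.val + 1 = 1 then (1 : L) else 0)).Local v)}
    (hmH : mH.IsCanonical P_H νH)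
    (hνH : νH ((((cmLocalIntegralLevel L 2 (Matrix.of fun i j : Fin 2 => if i.val + j.val + 1 = 2 then (1 : L) else 0) v).prod
      (cmLocalIntegralLevel L 1 (Matrix.of fun i j : Fin 1 => if i.val + j.val + 1 = 1 then (1 : L) else 0) v)) : Subgroup ((cmDatum L 2 (Matrix.of fun i j : Fin 2 => if i.val + j.val + 1 = 2 then (1 : L) else 0)).Local v ×
      (cmDatum L 1 (Matrix.of fun i j : Fin 1 => if i.val + j.val + 1 = 1 then (1 : L) else 0)).Local v)) :
        Set ((cmDatum L 2 (Matrix.of fun i j : Fin 2 => if i.val + j.val + 1 = 2 then (1 : L) else 0)).Local v ×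
      (cmDatum L 1 (Matrix.of fun i j : Fin 1 => if i.val + j.val + 1 = 1 then (1 : L) else 0)).Local v)) = 1)
    {γH : (cmDatum L 2 (Matrix.of fun i j : Fin 2 => if i.val + j.val + 1 = 2 then (1 : L) else 0)).Local v ×
      (cmDatum L 1 (Matrix.of fun i j : Fin 1 => if i.val + j.val + 1 = 1 then (1 : L) else 0)).Local v}
    (hγH : γH ∈ ((cmLocalIntegralLevel L 2 (Matrix.of fun i j : Fin 2 => if i.val + j.val + 1 = 2 then (1 : L) else 0) v).prod
      (cmLocalIntegralLevel L 1 (Matrix.of fun i j : Fin 1 => if i.val + j.val + 1 = 1 then (1 : L) else 0) v)))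
    (hPH : P_H (Quotient.out (ConjClasses.mk γH)))
    (hreg₂ : IsRegularElt ((γH.1).val : GL (Fin 2) (LocalRing L v)))
    {d : Fin 2 → (LocalRing L v)ˣ} (hd : glDiagonal 2 (LocalRing L v) d = ((γH.1).val : GL (Fin 2) (LocalRing L v)))
    (hb : IsUnit ((((d 0)⁻¹ * d 1 : (LocalRing L v)ˣ) : LocalRing L v) - 1))
    (hK₁ : ∀ x : (cmDatum L 1 (Matrix.of fun i j : Fin 1 => if i.val + j.val + 1 = 1 then (1 : L) else 0)).Local v, x ∈ cmLocalIntegralLevel L 1 (Matrix.of fun i j : Fin 1 => if i.val + j.val + 1 = 1 then (1 : L) else 0) v) :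
    classOrbitalIntegral mH (((((cmLocalIntegralLevel L 2 (Matrix.of fun i j : Fin 2 => if i.val + j.val + 1 = 2 then (1 : L) else 0) v).prod
      (cmLocalIntegralLevel L 1 (Matrix.of fun i j : Fin 1 => if i.val + j.val + 1 = 1 then (1 : L) else 0) v)) : Subgroup ((cmDatum L 2 (Matrix.of fun i j : Fin 2 => if i.val + j.val + 1 = 2 then (1 : L) else 0)).Local v ×
      (cmDatum L 1 (Matrix.of fun i j : Fin 1 => if i.val + j.val + 1 = 1 then (1 : L) else 0)).Local v)) :
        Set ((cmDatum L 2 (Matrix.of fun i j : Fin 2 => if i.val + j.val + 1 = 2 then (1 : L) else 0)).Local v ×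
      (cmDatum L 1 (Matrix.of fun i j : Fin 1 => if i.val + j.val + 1 = 1 then (1 : L) else 0)).Local v)).indicator fun _ => (1 : ℂ)) (ConjClasses.mk γH) =
      ((((NNReal.sqrt (unitModulusChar (LocalRing L v) hb.unit))⁻¹ : ℝ≥0) : ℝ) : ℂ) := by
  have hc := IsCMField.complexConj_ne_one L
  haveI : Algebra.IsQuadraticExtension ↥(maximalRealSubfield L) L := IsCMField.isQuadraticExtension L
  obtain ⟨γ₂, γ₁⟩ := γH
  -- the frame of the quasi-split forms `Φ₂`, `Φ₁`
  have hΦ₂ := antidiagOne_map_transpose (IsCMField.complexConj L) 2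
  have hΦ₁ := antidiagOne_map_transpose (IsCMField.complexConj L) 1
  have hΦ₂d : IsUnit (Matrix.of fun i j : Fin 2 => if i.val + j.val + 1 = 2 then (1 : L) else 0).det := by
    have h : (Matrix.of fun i j : Fin 2 => if i.val + j.val + 1 = 2 then (1 : L) else 0) = !![0, 1; 1, 0] := by
      ext i j; fin_cases i <;> fin_cases j <;> rfl
    rw [h, Matrix.det_fin_two_of]; norm_num
  have hΦ₁d : IsUnit (Matrix.of fun i j : Fin 1 => if i.val + j.val + 1 = 1 then (1 : L) else 0).det := by
    rw [Matrix.det_fin_one, Matrix.of_apply]; norm_num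
  have hreg₁ : IsRegularElt (γ₁.val : GL (Fin 1) (LocalRing L v)) := isRegularElt_of_fin_one _
  -- regularity of `diag(d)` in the all-pairs form, and at the place `w`
  have h10 : IsUnit ((d 1 : LocalRing L v) - d 0) := by
    have h := (d 0).isUnit.mul hb
    rwa [mul_sub, mul_one, Units.val_mul, Units.mul_inv_cancel_left] at h
  have hregd : ∀ i j : Fin 2, i ≠ j → IsUnit ((d i : LocalRing L v) - d j) := by
    intro i j hij
    fin_cases i <;> fin_cases j
    · exact absurd rfl hij
    · simpa using h10.neg
    · exact h10
    · exact absurd rfl hij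
  have hdw : ∀ i j : Fin 2, i ≠ j → IsUnit (((d i : (LocalRing L v)ˣ) : LocalRing L v) w - ((d j : (LocalRing L v)ˣ) : LocalRing L v) w) := by
    intro i j hij
    have h1 := (hregd i j hij).map (Pi.evalRingHom (fun w' : PlacesOver L v => w'.1.adicCompletion L) w)
    rwa [map_sub] at h1
  have hU := mul_comm_cmDatum_local_one L v
  -- Step 1: the normalised torus measure on `Z(γ_H)`; the class orbital integral as a `lintegral`
  haveI : IsClosed ((Subgroup.centralizer ({(γ₂, γ₁)} : Set ((cmDatum L 2 (Matrix.of fun i j : Fin 2 => if i.val + j.val + 1 = 2 then (1 : L) else 0)).Local v × (cmDatum L 1 (Matrix.of fun i j : Fin 1 => if i.val + j.val + 1 = 1 then (1 : L) else 0)).Local v)) : Subgroup ((cmDatum L 2 (Matrix.of fun i j : Fin 2 => if i.val + j.val + 1 = 2 then (1 : L) else 0)).Local v × (cmDatum L 1 (Matrix.of fun i j : Fin 1 => if i.val + j.val + 1 = 1 then (1 : L) else 0)).Local v)) : Set ((cmDatum L 2 (Matrix.of fun i j : Fin 2 => if i.val + j.val + 1 = 2 then (1 : L) else 0)).Local v ×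 (cmDatum L 1 (Matrix.of fun i j : Fin 1 => if i.val + j.val + 1 = 1 then (1 : L) else 0)).Local v)) := isClosed_coe_centralizer_singleton _
  haveI : BorelSpace ↥(Subgroup.centralizer ({(γ₂, γ₁)} : Set ((cmDatum L 2 (Matrix.of fun i j : Fin 2 => if i.val + j.val + 1 = 2 then (1 : L) else 0)).Local v × (cmDatum L 1 (Matrix.of fun i j : Fin 1 => if i.val + j.val + 1 = 1 then (1 : L) else 0)).Local v))) := Subtype.borelSpace _
  haveI : SecondCountableTopology ↥(Subgroup.centralizer ({(γ₂, γ₁)} : Set ((cmDatum L 2 (Matrix.of fun i j : Fin 2 => if i.val + j.val + 1 = 2 then (1 : L) else 0)).Local v × (cmDatum L 1 (Matrix.of fun i j : Fin 1 => if i.val + j.val + 1 = 1 then (1 : L) else 0)).Local v))) := TopologicalSpace.Subtype.secondCountableTopology _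
  haveI : LocallyCompactSpace ↥(Subgroup.centralizer ({(γ₂, γ₁)} : Set ((cmDatum L 2 (Matrix.of fun i j : Fin 2 => if i.val + j.val + 1 = 2 then (1 : L) else 0)).Local v × (cmDatum L 1 (Matrix.of fun i j : Fin 1 => if i.val + j.val + 1 = 1 then (1 : L) else 0)).Local v))) :=
    (isClosed_coe_centralizer_singleton (γ₂, γ₁)).isClosedEmbedding_subtypeVal.locallyCompactSpace
  have f₂ := compactCore_centralizer_local_facts_of_isRegularElt (IsCMField.complexConj L) 2 _ hc hΦ₂ hΦ₂d γ₂ hreg₂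
  have f₁ := compactCore_centralizer_local_facts_of_isRegularElt (IsCMField.complexConj L) 1 _ hc hΦ₁ hΦ₁d γ₁ hreg₁
  obtain ⟨tZ, htZ, htZi, htZ1⟩ :
      ∃ t : Measure ↥(Subgroup.centralizer ({(γ₂, γ₁)} : Set ((cmDatum L 2 (Matrix.of fun i j : Fin 2 => if i.val + j.val + 1 = 2 then (1 : L) else 0)).Local v × (cmDatum L 1 (Matrix.of fun i j : Fin 1 => if i.val + j.val + 1 = 1 then (1 : L) else 0)).Local v))), t.IsHaarMeasure ∧ t.IsInvInvariant ∧
        t (compactCore ↥(Subgroup.centralizer ({(γ₂, γ₁)} : Set ((cmDatum L 2 (Matrix.of fun i j : Fin 2 => if i.val + j.val + 1 = 2 then (1 : L) else 0)).Local v × (cmDatum L 1 (Matrix.of fun i j : Fin 1 => if i.val + j.val + 1 = 1 then (1 : L) else 0)).Local v)))) = 1 := by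
    refine exists_isHaarMeasure_compactCore_centralizer_prod_eq_one (A := (cmDatum L 2 (Matrix.of fun i j : Fin 2 => if i.val + j.val + 1 = 2 then (1 : L) else 0)).Local v) (B := (cmDatum L 1 (Matrix.of fun i j : Fin 1 => if i.val + j.val + 1 = 1 then (1 : L) else 0)).Local v) γ₂ γ₁ ?_ ?_ ?_ ?_ ?_ ?_
    · exact f₂.1
    · exact f₁.1
    · exact f₂.2.1
    · exact f₂.2.2
    · exact f₁.2.1
    · exact f₁.2.2
  haveI := htZ
  haveI := htZi
  have hKHco := isCompact_isOpen_cmLocalIntegralLevel_prod L 2 1 (Matrix.of fun i j : Fin 2 => if i.val + j.val + 1 = 2 then (1 : L) else 0) (Matrix.of fun i j : Fin 1 => if i.val + j.val + 1 = 1 then (1 : L) else 0) v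
  rw [hmH.classOrbitalIntegral_mk_eq_orbitalIntegral hPH tZ htZ1, orbitalIntegral_indicator_complex_eq_ofReal,
    orbitalIntegral_indicator_eq_toReal_lintegral _ _ hKHco.2]
  congr 1
  -- `compactCore Z(γ_H) ⊆ K_H`: compact subgroups of `Z(γ₂)` are integral at `w` (★ C1) — on the frame's own carriers
  have hZ' : ∀ g : ((cmDatum L 2 (Matrix.of fun i j : Fin 2 => if i.val + j.val + 1 = 2 then (1 : L) else 0)).Local v × (cmDatum L 1 (Matrix.of fun i j : Fin 1 => if i.val + j.val + 1 = 1 then (1 : L) else 0)).Local v), g ∈ Subgroup.centralizer ({(γ₂, γ₁)} : Set ((cmDatum L 2 (Matrix.of fun i j : Fin 2 => if i.val + j.val + 1 = 2 then (1 : L) else 0)).Local v × (cmDatum L 1 (Matrix.of fun i j : Fin 1 => if i.val + j.val + 1 = 1 then (1 : L) else 0)).Local v)) ↔ g.1 ∈ Subgroup.centralizer ({γ₂} : Set ((cmDatum L 2 (Matrix.of fun i j : Fin 2 => if i.val + j.val + 1 = 2 then (1 : L) else 0)).Local v)) := by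
    intro g
    rw [Subgroup.mem_centralizer_singleton_iff, Subgroup.mem_centralizer_singleton_iff, Prod.ext_iff, Prod.fst_mul, Prod.fst_mul, Prod.snd_mul, Prod.snd_mul]
    exact ⟨fun h => h.1, fun h => ⟨h, hU _ _⟩⟩
  have hγ₂w : (((localNonsplitEquiv (IsCMField.complexConj L) (Matrix.of fun i j : Fin 2 => if i.val + j.val + 1 = 2 then (1 : L) else 0) hc w hw γ₂ :
        ↥(unitaryGroupOfForm (galAdicCompletionMap (L := L) (IsCMField.complexConj L) hw) (placeForm (Matrix.of fun i j : Fin 2 => if i.val + j.val + 1 = 2 then (1 : L) else 0) w.1))) :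
        GL (Fin 2) (w.1.adicCompletion L)) : Matrix (Fin 2) (Fin 2) (w.1.adicCompletion L)) =
      Matrix.diagonal fun i => ((d i : (LocalRing L v)ˣ) : LocalRing L v) w := by
    rw [coe_coe_localNonsplitEquiv_apply, ← hd, coe_glDiagonal,
      Matrix.diagonal_map (RingHom.map_zero (Pi.evalRingHom (fun w' : PlacesOver L v => w'.1.adicCompletion L) w))]
    rfl
  have hint : ∀ C' : Subgroup ((cmDatum L 2 (Matrix.of fun i j : Fin 2 => if i.val + j.val + 1 = 2 then (1 : L) else 0)).Local v), IsCompact (C' : Set ((cmDatum L 2 (Matrix.of fun i j : Fin 2 => if i.val + j.val + 1 = 2 then (1 : L) else 0)).Local v)) →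
      C' ≤ Subgroup.centralizer ({γ₂} : Set ((cmDatum L 2 (Matrix.of fun i j : Fin 2 => if i.val + j.val + 1 = 2 then (1 : L) else 0)).Local v)) → C' ≤ cmLocalIntegralLevel L 2 (Matrix.of fun i j : Fin 2 => if i.val + j.val + 1 = 2 then (1 : L) else 0) v := by
    intro C' hC' hC'Z c hcC
    let φ : ((cmDatum L 2 (Matrix.of fun i j : Fin 2 => if i.val + j.val + 1 = 2 then (1 : L) else 0)).Local v) →* GL (Fin 2) (w.1.adicCompletion L) :=
      (unitaryGroupOfForm (galAdicCompletionMap (L := L) (IsCMField.complexConj L) hw) (placeForm (Matrix.of fun i j : Fin 2 => if i.val + j.val + 1 = 2 then (1 : L) else 0) w.1)).subtype.comp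
        (localNonsplitEquiv (IsCMField.complexConj L) (Matrix.of fun i j : Fin 2 => if i.val + j.val + 1 = 2 then (1 : L) else 0) hc w hw).toMulEquiv.toMonoidHom
    have hφ : Continuous φ := continuous_subtype_val.comp (localNonsplitEquiv (IsCMField.complexConj L) (Matrix.of fun i j : Fin 2 => if i.val + j.val + 1 = 2 then (1 : L) else 0) hc w hw).continuous
    have hCc : IsCompact ((C'.map φ : Subgroup (GL (Fin 2) (w.1.adicCompletion L))) : Set (GL (Fin 2) (w.1.adicCompletion L))) := by
      rw [Subgroup.coe_map]; exact hC'.image hφ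
    have hCZ : C'.map φ ≤ Subgroup.centralizer ({φ γ₂} : Set (GL (Fin 2) (w.1.adicCompletion L))) := by
      rintro _ ⟨x, hx, rfl⟩
      rw [Subgroup.mem_centralizer_singleton_iff, ← map_mul, ← map_mul, Subgroup.mem_centralizer_singleton_iff.1 (hC'Z hx)]
    have hle := subgroup_le_glInt_of_isCompact_of_le_centralizer_diagonal 2 (w.1) hγ₂w hdw _ hCc hCZ
    exact (mem_localIntegralLevel_iff_of_smul_eq (IsCMField.complexConj L) 2 _ hc w hw c).2 (hle ⟨c, hcC, rfl⟩)
  have hcore := compactCore_subset_preimage_prod (K₁ := cmLocalIntegralLevel L 1 (Matrix.of fun i j : Fin 1 => if i.val + j.val + 1 = 1 then (1 : L) else 0) v) hZ' hint hK₁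
  -- Step 2: the re-spelled product `G = U(Φ₂)(L⁺_v) × U(Φ₁)(L⁺_v)` and `Ψ : H_v ≃ G`
  set G2 := ↥(unitaryGroupOfForm (conjLocal L (IsCMField.complexConj L) v) (cmLocalForm L 2 v)) with hG2def
  let Ψ : ((cmDatum L 2 (Matrix.of fun i j : Fin 2 => if i.val + j.val + 1 = 2 then (1 : L) else 0)).Local v × (cmDatum L 1 (Matrix.of fun i j : Fin 1 => if i.val + j.val + 1 = 1 then (1 : L) else 0)).Local v) ≃* G2 × (cmDatum L 1 (Matrix.of fun i j : Fin 1 => if i.val + j.val + 1 = 1 then (1 : L) else 0)).Local v :=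
    { toFun := fun g => (⟨g.1.val, g.1.property⟩, g.2)
      invFun := fun g => (⟨g.1.val, g.1.property⟩, g.2)
      left_inv := fun _ => rfl
      right_inv := fun _ => rfl
      map_mul' := fun _ _ => rfl }
  have hΨ : Continuous Ψ := ((continuous_subtype_val.comp continuous_fst).subtype_mk _).prodMk continuous_snd
  have hΨs : Continuous Ψ.symm := ((continuous_subtype_val.comp continuous_fst).subtype_mk _).prodMk continuous_snd
  have hΨ1 : ∀ g : ((cmDatum L 2 (Matrix.of fun i j : Fin 2 => if i.val + j.val + 1 = 2 then (1 : L) else 0)).Local v × (cmDatum L 1 (Matrix.of fun i j : Fin 1 => if i.val + j.val + 1 = 1 then (1 : L) else 0)).Local v), ((Ψ g).1 : GL (Fin 2) (LocalRing L v)) = g.1.val := fun _ => rfl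
  have hΨ2 : ∀ g : ((cmDatum L 2 (Matrix.of fun i j : Fin 2 => if i.val + j.val + 1 = 2 then (1 : L) else 0)).Local v × (cmDatum L 1 (Matrix.of fun i j : Fin 1 => if i.val + j.val + 1 = 1 then (1 : L) else 0)).Local v), (Ψ g).2 = g.2 := fun _ => rfl
  set t₂ : G2 := (Ψ (γ₂, γ₁)).1 with ht₂def
  have ht₂ : t₂ ∈ torusU (conjLocal L (IsCMField.complexConj L) v) (cmLocalForm L 2 v) := ⟨d, hd⟩
  have hdt : glDiagonal 2 (LocalRing L v) d = (t₂ : GL (Fin 2) (LocalRing L v)) := hd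
  letI mG : MeasurableSpace (G2 × (cmDatum L 1 (Matrix.of fun i j : Fin 1 => if i.val + j.val + 1 = 1 then (1 : L) else 0)).Local v) := borel _
  haveI : BorelSpace (G2 × (cmDatum L 1 (Matrix.of fun i j : Fin 1 => if i.val + j.val + 1 = 1 then (1 : L) else 0)).Local v) := ⟨rfl⟩
  letI mG2 : MeasurableSpace G2 := borel _
  haveI : BorelSpace G2 := ⟨rfl⟩
  haveI : LocallyCompactSpace G2 := locallyCompactSpace_local (IsCMField.complexConj L) 2 _ v
  haveI : SecondCountableTopology G2 := secondCountableTopology_local (IsCMField.complexConj L) 2 _ v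
  letI mQ : MeasurableSpace ((G2 × (cmDatum L 1 (Matrix.of fun i j : Fin 1 => if i.val + j.val + 1 = 1 then (1 : L) else 0)).Local v) ⧸ ((torusU (conjLocal L (IsCMField.complexConj L) v) (cmLocalForm L 2 v)).prod (⊤ : Subgroup ((cmDatum L 1 (Matrix.of fun i j : Fin 1 => if i.val + j.val + 1 = 1 then (1 : L) else 0)).Local v)))) := borel _
  haveI : BorelSpace ((G2 × (cmDatum L 1 (Matrix.of fun i j : Fin 1 => if i.val + j.val + 1 = 1 then (1 : L) else 0)).Local v) ⧸ ((torusU (conjLocal L (IsCMField.complexConj L) v) (cmLocalForm L 2 v)).prod (⊤ : Subgroup ((cmDatum L 1 (Matrix.of fun i j : Fin 1 => if i.val + j.val + 1 = 1 then (1 : L) else 0)).Local v)))) := ⟨rfl⟩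
  -- the subgroups `T = T₂ × U`, `N = N₂ × 1`, `B = B₂ × U`, `K = K₂ × K₁` of `G`
  obtain ⟨K2, hK2⟩ : ∃ K2 : Subgroup G2, K2 = cmLocalIntegralLevel L 2 (Matrix.of fun i j : Fin 2 => if i.val + j.val + 1 = 2 then (1 : L) else 0) v := ⟨_, rfl⟩
  have hK2co : IsCompact (K2 : Set G2) ∧ IsOpen (K2 : Set G2) := by
    rw [hK2]; exact isCompact_isOpen_cmLocalIntegralLevel L 2 (Matrix.of fun i j : Fin 2 => if i.val + j.val + 1 = 2 then (1 : L) else 0) v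
  have hK1co := isCompact_isOpen_cmLocalIntegralLevel L 1 (Matrix.of fun i j : Fin 1 => if i.val + j.val + 1 = 1 then (1 : L) else 0) v
  have hKco : IsCompact (((K2.prod (cmLocalIntegralLevel L 1 (Matrix.of fun i j : Fin 1 => if i.val + j.val + 1 = 1 then (1 : L) else 0) v)) : Subgroup (G2 × (cmDatum L 1 (Matrix.of fun i j : Fin 1 => if i.val + j.val + 1 = 1 then (1 : L) else 0)).Local v)) : Set (G2 × (cmDatum L 1 (Matrix.of fun i j : Fin 1 => if i.val + j.val + 1 = 1 then (1 : L) else 0)).Local v)) ∧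
      IsOpen (((K2.prod (cmLocalIntegralLevel L 1 (Matrix.of fun i j : Fin 1 => if i.val + j.val + 1 = 1 then (1 : L) else 0) v)) : Subgroup (G2 × (cmDatum L 1 (Matrix.of fun i j : Fin 1 => if i.val + j.val + 1 = 1 then (1 : L) else 0)).Local v)) : Set (G2 × (cmDatum L 1 (Matrix.of fun i j : Fin 1 => if i.val + j.val + 1 = 1 then (1 : L) else 0)).Local v)) := by
    rw [Subgroup.coe_prod]; exact ⟨hK2co.1.prod hK1co.1, hK2co.2.prod hK1co.2⟩
  have hZ : ∀ g : G2 × (cmDatum L 1 (Matrix.of fun i j : Fin 1 => if i.val + j.val + 1 = 1 then (1 : L) else 0)).Local v, g ∈ (torusU (conjLocal L (IsCMField.complexConj L) v) (cmLocalForm L 2 v)).prod (⊤ : Subgroup ((cmDatum L 1 (Matrix.of fun i j : Fin 1 => if i.val + j.val + 1 = 1 then (1 : L) else 0)).Local v)) ↔ g.1 ∈ torusU (conjLocal L (IsCMField.complexConj L) v) (cmLocalForm L 2 v) := fun g => by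
    rw [Subgroup.mem_prod]; exact ⟨fun h => h.1, fun h => ⟨h, Subgroup.mem_top _⟩⟩
  have hT₂ : IsClosed ((torusU (conjLocal L (IsCMField.complexConj L) v) (cmLocalForm L 2 v)) : Set G2) := isClosed_torusU_two _ _
  have hN₂ : IsClosed ((unipotentU (conjLocal L (IsCMField.complexConj L) v) (cmLocalForm L 2 v)) : Set G2) := isClosed_unipotentU _ _
  have hT : IsClosed ((((torusU (conjLocal L (IsCMField.complexConj L) v) (cmLocalForm L 2 v)).prod (⊤ : Subgroup ((cmDatum L 1 (Matrix.of fun i j : Fin 1 => if i.val + j.val + 1 = 1 then (1 : L) else 0)).Local v))) : Subgroup (G2 × (cmDatum L 1 (Matrix.of fun i j : Fin 1 => if i.val + j.val + 1 = 1 then (1 : L) else 0)).Local v)) : Set (G2 × (cmDatum L 1 (Matrix.of fun i j : Fin 1 => if i.val + j.val + 1 = 1 then (1 : L) else 0)).Local v)) :=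
    isClosed_coe_prod _ _ hT₂ (by rw [Subgroup.coe_top]; exact isClosed_univ)
  have hB : IsClosed ((((borelU (conjLocal L (IsCMField.complexConj L) v) (cmLocalForm L 2 v)).prod (⊤ : Subgroup ((cmDatum L 1 (Matrix.of fun i j : Fin 1 => if i.val + j.val + 1 = 1 then (1 : L) else 0)).Local v))) : Subgroup (G2 × (cmDatum L 1 (Matrix.of fun i j : Fin 1 => if i.val + j.val + 1 = 1 then (1 : L) else 0)).Local v)) : Set (G2 × (cmDatum L 1 (Matrix.of fun i j : Fin 1 => if i.val + j.val + 1 = 1 then (1 : L) else 0)).Local v)) :=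
    isClosed_coe_prod _ _ (isClosed_borelU _ _) (by rw [Subgroup.coe_top]; exact isClosed_univ)
  have hNc : IsClosed ((((unipotentU (conjLocal L (IsCMField.complexConj L) v) (cmLocalForm L 2 v)).prod (⊥ : Subgroup ((cmDatum L 1 (Matrix.of fun i j : Fin 1 => if i.val + j.val + 1 = 1 then (1 : L) else 0)).Local v))) : Subgroup (G2 × (cmDatum L 1 (Matrix.of fun i j : Fin 1 => if i.val + j.val + 1 = 1 then (1 : L) else 0)).Local v)) : Set (G2 × (cmDatum L 1 (Matrix.of fun i j : Fin 1 => if i.val + j.val + 1 = 1 then (1 : L) else 0)).Local v)) :=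
    isClosed_coe_prod _ _ hN₂ (by rw [Subgroup.coe_bot]; exact isClosed_singleton)
  haveI : LocallyCompactSpace ↥((torusU (conjLocal L (IsCMField.complexConj L) v) (cmLocalForm L 2 v)).prod (⊤ : Subgroup ((cmDatum L 1 (Matrix.of fun i j : Fin 1 => if i.val + j.val + 1 = 1 then (1 : L) else 0)).Local v))) := hT.isClosedEmbedding_subtypeVal.locallyCompactSpace
  haveI : SecondCountableTopology ↥((torusU (conjLocal L (IsCMField.complexConj L) v) (cmLocalForm L 2 v)).prod (⊤ : Subgroup ((cmDatum L 1 (Matrix.of fun i j : Fin 1 => if i.val + j.val + 1 = 1 then (1 : L) else 0)).Local v))) := TopologicalSpace.Subtype.secondCountableTopology _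
  haveI : LocallyCompactSpace ↥((unipotentU (conjLocal L (IsCMField.complexConj L) v) (cmLocalForm L 2 v)).prod (⊥ : Subgroup ((cmDatum L 1 (Matrix.of fun i j : Fin 1 => if i.val + j.val + 1 = 1 then (1 : L) else 0)).Local v))) := hNc.isClosedEmbedding_subtypeVal.locallyCompactSpace
  haveI : SecondCountableTopology ↥((unipotentU (conjLocal L (IsCMField.complexConj L) v) (cmLocalForm L 2 v)).prod (⊥ : Subgroup ((cmDatum L 1 (Matrix.of fun i j : Fin 1 => if i.val + j.val + 1 = 1 then (1 : L) else 0)).Local v))) := TopologicalSpace.Subtype.secondCountableTopology _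
  haveI : LocallyCompactSpace ↥((K2.prod (cmLocalIntegralLevel L 1 (Matrix.of fun i j : Fin 1 => if i.val + j.val + 1 = 1 then (1 : L) else 0) v)) : Subgroup (G2 × (cmDatum L 1 (Matrix.of fun i j : Fin 1 => if i.val + j.val + 1 = 1 then (1 : L) else 0)).Local v)) := hKco.1.isClosed.isClosedEmbedding_subtypeVal.locallyCompactSpace
  haveI : SecondCountableTopology ↥((K2.prod (cmLocalIntegralLevel L 1 (Matrix.of fun i j : Fin 1 => if i.val + j.val + 1 = 1 then (1 : L) else 0) v)) : Subgroup (G2 × (cmDatum L 1 (Matrix.of fun i j : Fin 1 => if i.val + j.val + 1 = 1 then (1 : L) else 0)).Local v)) := TopologicalSpace.Subtype.secondCountableTopology _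
  -- `Ψ Z(γ_H) = T`
  have hZT : ∀ g : ((cmDatum L 2 (Matrix.of fun i j : Fin 2 => if i.val + j.val + 1 = 2 then (1 : L) else 0)).Local v × (cmDatum L 1 (Matrix.of fun i j : Fin 1 => if i.val + j.val + 1 = 1 then (1 : L) else 0)).Local v), Ψ g ∈ (torusU (conjLocal L (IsCMField.complexConj L) v) (cmLocalForm L 2 v)).prod (⊤ : Subgroup ((cmDatum L 1 (Matrix.of fun i j : Fin 1 => if i.val + j.val + 1 = 1 then (1 : L) else 0)).Local v)) ↔ g ∈ Subgroup.centralizer ({(γ₂, γ₁)} : Set ((cmDatum L 2 (Matrix.of fun i j : Fin 2 => if i.val + j.val + 1 = 2 then (1 : L) else 0)).Local v × (cmDatum L 1 (Matrix.of fun i j : Fin 1 => if i.val + j.val + 1 = 1 then (1 : L) else 0)).Local v)) := by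
    intro g
    rw [hZ, hZ', mem_torusU_iff_mem_centralizer_of_isUnit_sub hdt hregd (Ψ g).1, Subgroup.mem_centralizer_singleton_iff,
      Subgroup.mem_centralizer_singleton_iff]
    change (Ψ g).1 * (Ψ (γ₂, γ₁)).1 = (Ψ (γ₂, γ₁)).1 * (Ψ g).1 ↔ g.1 * γ₂ = γ₂ * g.1
    rw [← Prod.fst_mul, ← Prod.fst_mul, ← map_mul, ← map_mul]
    constructor
    · intro h
      have h' := congrArg Prod.fst (Ψ.injective (Prod.ext h (by rw [hΨ2, hΨ2, Prod.snd_mul, Prod.snd_mul, hU])))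
      simpa using h'
    · intro h
      have h' : g * (γ₂, γ₁) = (γ₂, γ₁) * g := Prod.ext (by simpa using h) (hU _ _)
      rw [h']
  -- Step 3: Haar measures on `G`, its subgroups, and the Iwasawa form of `Ψ_*νH ∕ Ψ_*t_Z`
  obtain ⟨ν, hν⟩ : ∃ ν : Measure (G2 × (cmDatum L 1 (Matrix.of fun i j : Fin 1 => if i.val + j.val + 1 = 1 then (1 : L) else 0)).Local v), ν = Measure.map Ψ νH := ⟨_, rfl⟩
  haveI : ν.IsHaarMeasure := by rw [hν]; exact MulEquiv.isHaarMeasure_map νH Ψ hΨ hΨs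
  haveI : ν.IsMulRightInvariant := by rw [hν]; exact isMulRightInvariant_map_mulEquiv_of_isMulRightInvariant Ψ hΨ.measurable νH
  haveI : ν.IsInvInvariant := isInvInvariant_of_isMulRightInvariant ν
  let eH := subgroupCongrHomeomorph Ψ (Subgroup.centralizer ({(γ₂, γ₁)} : Set ((cmDatum L 2 (Matrix.of fun i j : Fin 2 => if i.val + j.val + 1 = 2 then (1 : L) else 0)).Local v × (cmDatum L 1 (Matrix.of fun i j : Fin 1 => if i.val + j.val + 1 = 1 then (1 : L) else 0)).Local v))) ((torusU (conjLocal L (IsCMField.complexConj L) v) (cmLocalForm L 2 v)).prod (⊤ : Subgroup ((cmDatum L 1 (Matrix.of fun i j : Fin 1 => if i.val + j.val + 1 = 1 then (1 : L) else 0)).Local v))) hZT hΨ hΨs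
  let eZ : ↥(Subgroup.centralizer ({(γ₂, γ₁)} : Set ((cmDatum L 2 (Matrix.of fun i j : Fin 2 => if i.val + j.val + 1 = 2 then (1 : L) else 0)).Local v × (cmDatum L 1 (Matrix.of fun i j : Fin 1 => if i.val + j.val + 1 = 1 then (1 : L) else 0)).Local v))) ≃ₜ* ↥((torusU (conjLocal L (IsCMField.complexConj L) v) (cmLocalForm L 2 v)).prod (⊤ : Subgroup ((cmDatum L 1 (Matrix.of fun i j : Fin 1 => if i.val + j.val + 1 = 1 then (1 : L) else 0)).Local v))) :=
    { toMulEquiv :=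
        { toEquiv := eH.toEquiv
          map_mul' := fun a b => Subtype.ext (map_mul Ψ (a : ((cmDatum L 2 (Matrix.of fun i j : Fin 2 => if i.val + j.val + 1 = 2 then (1 : L) else 0)).Local v × (cmDatum L 1 (Matrix.of fun i j : Fin 1 => if i.val + j.val + 1 = 1 then (1 : L) else 0)).Local v)) (b : ((cmDatum L 2 (Matrix.of fun i j : Fin 2 => if i.val + j.val + 1 = 2 then (1 : L) else 0)).Local v × (cmDatum L 1 (Matrix.of fun i j : Fin 1 => if i.val + j.val + 1 = 1 then (1 : L) else 0)).Local v))) }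
      continuous_toFun := eH.continuous
      continuous_invFun := eH.symm.continuous }
  have heZ : (eZ : _ → ↥((torusU (conjLocal L (IsCMField.complexConj L) v) (cmLocalForm L 2 v)).prod (⊤ : Subgroup ((cmDatum L 1 (Matrix.of fun i j : Fin 1 => if i.val + j.val + 1 = 1 then (1 : L) else 0)).Local v)))) = eH := rfl
  obtain ⟨tT, htT⟩ : ∃ tT : Measure ↥((torusU (conjLocal L (IsCMField.complexConj L) v) (cmLocalForm L 2 v)).prod (⊤ : Subgroup ((cmDatum L 1 (Matrix.of fun i j : Fin 1 => if i.val + j.val + 1 = 1 then (1 : L) else 0)).Local v))), tT = Measure.map eH tZ := ⟨_, rfl⟩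
  haveI : tT.IsHaarMeasure := by rw [htT, ← heZ]; exact MulEquiv.isHaarMeasure_map tZ eZ.toMulEquiv eZ.continuous eZ.symm.continuous
  haveI : tT.IsInvInvariant := by rw [htT, ← heZ]; exact isInvInvariant_map_mulEquiv eZ.toMulEquiv eZ.continuous.measurable tZ
  obtain ⟨κ, hκ⟩ : ∃ κ : Measure ↥((K2.prod (cmLocalIntegralLevel L 1 (Matrix.of fun i j : Fin 1 => if i.val + j.val + 1 = 1 then (1 : L) else 0) v)) : Subgroup (G2 × (cmDatum L 1 (Matrix.of fun i j : Fin 1 => if i.val + j.val + 1 = 1 then (1 : L) else 0)).Local v)), κ.IsHaarMeasure := ⟨Measure.haar, inferInstance⟩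
  obtain ⟨μN, hμN⟩ : ∃ μN : Measure ↥((unipotentU (conjLocal L (IsCMField.complexConj L) v) (cmLocalForm L 2 v)).prod (⊥ : Subgroup ((cmDatum L 1 (Matrix.of fun i j : Fin 1 => if i.val + j.val + 1 = 1 then (1 : L) else 0)).Local v))), μN.IsHaarMeasure := ⟨Measure.haar, inferInstance⟩
  haveI : μN.IsInvInvariant := Literature.MeasureTheory.Group.isInvInvariant_of_comm _ hNc (fun x hx y hy =>
    congrArg Subtype.val (mul_comm_prodBot (fun a b => mul_comm_two (conjLocal L (IsCMField.complexConj L) v) (J := cmLocalForm L 2 v) a b) ⟨x, hx⟩ ⟨y, hy⟩)) μN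
  haveI : SMulInvariantMeasure (G2 × (cmDatum L 1 (Matrix.of fun i j : Fin 1 => if i.val + j.val + 1 = 1 then (1 : L) else 0)).Local v) ((G2 × (cmDatum L 1 (Matrix.of fun i j : Fin 1 => if i.val + j.val + 1 = 1 then (1 : L) else 0)).Local v) ⧸ ((torusU (conjLocal L (IsCMField.complexConj L) v) (cmLocalForm L 2 v)).prod (⊤ : Subgroup ((cmDatum L 1 (Matrix.of fun i j : Fin 1 => if i.val + j.val + 1 = 1 then (1 : L) else 0)).Local v))))
      (quotientMeasure ((torusU (conjLocal L (IsCMField.complexConj L) v) (cmLocalForm L 2 v)).prod (⊤ : Subgroup ((cmDatum L 1 (Matrix.of fun i j : Fin 1 => if i.val + j.val + 1 = 1 then (1 : L) else 0)).Local v))) tT hT ν) := smulInvariantMeasure_quotientMeasure _ tT hT ν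
  have hμ0 : quotientMeasure ((torusU (conjLocal L (IsCMField.complexConj L) v) (cmLocalForm L 2 v)).prod (⊤ : Subgroup ((cmDatum L 1 (Matrix.of fun i j : Fin 1 => if i.val + j.val + 1 = 1 then (1 : L) else 0)).Local v))) tT hT ν ≠ 0 := quotientMeasure_ne_zero _ tT hT ν
  have hTN := conj_mem_prodBot hZ (fun a ha n hn => conj_mem_unipotentU_cmLocal_two L v ha hn)
  have hKP : ∀ ⦃m n : G2 × (cmDatum L 1 (Matrix.of fun i j : Fin 1 => if i.val + j.val + 1 = 1 then (1 : L) else 0)).Local v⦄, m ∈ (torusU (conjLocal L (IsCMField.complexConj L) v) (cmLocalForm L 2 v)).prod (⊤ : Subgroup ((cmDatum L 1 (Matrix.of fun i j : Fin 1 => if i.val + j.val + 1 = 1 then (1 : L) else 0)).Local v)) → n ∈ (unipotentU (conjLocal L (IsCMField.complexConj L) v) (cmLocalForm L 2 v)).prod (⊥ : Subgroup ((cmDatum L 1 (Matrix.of fun i j : Fin 1 => if i.val + j.val + 1 = 1 then (1 : L) else 0)).Local v)) →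
      m * n ∈ K2.prod (cmLocalIntegralLevel L 1 (Matrix.of fun i j : Fin 1 => if i.val + j.val + 1 = 1 then (1 : L) else 0) v) → m ∈ K2.prod (cmLocalIntegralLevel L 1 (Matrix.of fun i j : Fin 1 => if i.val + j.val + 1 = 1 then (1 : L) else 0) v) := by
    refine mem_prod_of_mul_mem hZ (fun m u hm hu h => ?_) hK₁
    rw [hK2] at h ⊢
    exact mem_cmLocalIntegralLevel_of_torus_mul_unipotent L 2 v hm hu h
  have hKB : ∀ g : G2 × (cmDatum L 1 (Matrix.of fun i j : Fin 1 => if i.val + j.val + 1 = 1 then (1 : L) else 0)).Local v, ∃ k ∈ K2.prod (cmLocalIntegralLevel L 1 (Matrix.of fun i j : Fin 1 => if i.val + j.val + 1 = 1 then (1 : L) else 0) v), ∃ b ∈ (borelU (conjLocal L (IsCMField.complexConj L) v) (cmLocalForm L 2 v)).prod (⊤ : Subgroup ((cmDatum L 1 (Matrix.of fun i j : Fin 1 => if i.val + j.val + 1 = 1 then (1 : L) else 0)).Local v)), g = k * b := by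
    refine exists_mem_prod_mul fun g => ?_
    obtain ⟨k, hk, b, hb⟩ := exists_mem_cmLocalIntegralLevel_mul_borel L 2 v g
    exact ⟨k, by rw [hK2]; exact hk, b.1, b.2, hb⟩
  obtain ⟨e₂, he₂⟩ := exists_borelHomeomorph_two (conjLocal L (IsCMField.complexConj L) v) (cmLocalForm_eq_over L 2 v)
  obtain ⟨e, he⟩ := exists_homeomorph_prod_anMap (U := (cmDatum L 1 (Matrix.of fun i j : Fin 1 => if i.val + j.val + 1 = 1 then (1 : L) else 0)).Local v) (torusU_le_borelU _ _) (unipotentU_le_borelU _ _) hZ e₂ he₂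
  obtain ⟨C, -, hμC⟩ := exists_measure_quotient_eq_smul_map hKco.1 hT hB (le_prod_top hZ (torusU_le_borelU _ _))
    (prodBot_le_prod_top (unipotentU_le_borelU _ _)) hTN e he hKB ν κ tT μN (quotientMeasure ((torusU (conjLocal L (IsCMField.complexConj L) v) (cmLocalForm L 2 v)).prod (⊤ : Subgroup ((cmDatum L 1 (Matrix.of fun i j : Fin 1 => if i.val + j.val + 1 = 1 then (1 : L) else 0)).Local v))) tT hT ν) hμ0
  -- Step 4: the two normalisations read on `G`
  have hK' : ∀ g : ((cmDatum L 2 (Matrix.of fun i j : Fin 2 => if i.val + j.val + 1 = 2 then (1 : L) else 0)).Local v × (cmDatum L 1 (Matrix.of fun i j : Fin 1 => if i.val + j.val + 1 = 1 then (1 : L) else 0)).Local v), g ∈ ((cmLocalIntegralLevel L 2 (Matrix.of fun i j : Fin 2 => if i.val + j.val + 1 = 2 then (1 : L) else 0) v).prod (cmLocalIntegralLevel L 1 (Matrix.of fun i j : Fin 1 => if i.val + j.val + 1 = 1 then (1 : L) else 0) v)) ↔ Ψ g ∈ K2.prod (cmLocalIntegralLevel L 1 (Matrix.of fun i j : Fin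 1 => if i.val + j.val + 1 = 1 then (1 : L) else 0) v) := fun g => by
    rw [Subgroup.mem_prod, Subgroup.mem_prod, hK2]; exact Iff.rfl
  have hΨm : Measurable (Ψ : ((cmDatum L 2 (Matrix.of fun i j : Fin 2 => if i.val + j.val + 1 = 2 then (1 : L) else 0)).Local v × (cmDatum L 1 (Matrix.of fun i j : Fin 1 => if i.val + j.val + 1 = 1 then (1 : L) else 0)).Local v) → G2 × (cmDatum L 1 (Matrix.of fun i j : Fin 1 => if i.val + j.val + 1 = 1 then (1 : L) else 0)).Local v) := hΨ.measurable
  have hν1 : ν (K2.prod (cmLocalIntegralLevel L 1 (Matrix.of fun i j : Fin 1 => if i.val + j.val + 1 = 1 then (1 : L) else 0) v)) = 1 := by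
    rw [hν, Measure.map_apply hΨm hKco.2.measurableSet]
    have hpre : (Ψ : ((cmDatum L 2 (Matrix.of fun i j : Fin 2 => if i.val + j.val + 1 = 2 then (1 : L) else 0)).Local v × (cmDatum L 1 (Matrix.of fun i j : Fin 1 => if i.val + j.val + 1 = 1 then (1 : L) else 0)).Local v) → G2 × (cmDatum L 1 (Matrix.of fun i j : Fin 1 => if i.val + j.val + 1 = 1 then (1 : L) else 0)).Local v) ⁻¹' ((K2.prod (cmLocalIntegralLevel L 1 (Matrix.of fun i j : Fin 1 => if i.val + j.val + 1 = 1 then (1 : L) else 0) v) : Subgroup (G2 × (cmDatum L 1 (Matrix.of fun i j : Fin 1 => if i.val + j.val + 1 = 1 then (1 : L) else 0)).Local v)) : Set (G2 × (cmDatum L 1 (Matrix.of fun i j : Fin 1 => if i.val + j.val + 1 = 1 then (1 : L) else 0)).Local v)) =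
        ((((cmLocalIntegralLevel L 2 (Matrix.of fun i j : Fin 2 => if i.val + j.val + 1 = 2 then (1 : L) else 0) v).prod (cmLocalIntegralLevel L 1 (Matrix.of fun i j : Fin 1 => if i.val + j.val + 1 = 1 then (1 : L) else 0) v)) : Subgroup ((cmDatum L 2 (Matrix.of fun i j : Fin 2 => if i.val + j.val + 1 = 2 then (1 : L) else 0)).Local v × (cmDatum L 1 (Matrix.of fun i j : Fin 1 => if i.val + j.val + 1 = 1 then (1 : L) else 0)).Local v)) : Set ((cmDatum L 2 (Matrix.of fun i j : Fin 2 => if i.val + j.val + 1 = 2 then (1 : L) else 0)).Local v × (cmDatum L 1 (Matrix.of fun i j : Fin 1 => if i.val + j.val + 1 = 1 then (1 : L) else 0)).Local v)) := by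
      ext g; exact (hK' g).symm
    rw [hpre, hνH]
  have htK1 : tT (Subtype.val ⁻¹' ((K2.prod (cmLocalIntegralLevel L 1 (Matrix.of fun i j : Fin 1 => if i.val + j.val + 1 = 1 then (1 : L) else 0) v) : Subgroup (G2 × (cmDatum L 1 (Matrix.of fun i j : Fin 1 => if i.val + j.val + 1 = 1 then (1 : L) else 0)).Local v)) : Set (G2 × (cmDatum L 1 (Matrix.of fun i j : Fin 1 => if i.val + j.val + 1 = 1 then (1 : L) else 0)).Local v))) = 1 := by
    rw [htT, Measure.map_apply eH.continuous.measurable (hKco.2.preimage continuous_subtype_val).measurableSet]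
    have hpre : (eH : _ → ↥((torusU (conjLocal L (IsCMField.complexConj L) v) (cmLocalForm L 2 v)).prod (⊤ : Subgroup ((cmDatum L 1 (Matrix.of fun i j : Fin 1 => if i.val + j.val + 1 = 1 then (1 : L) else 0)).Local v)))) ⁻¹'
        (Subtype.val ⁻¹' ((K2.prod (cmLocalIntegralLevel L 1 (Matrix.of fun i j : Fin 1 => if i.val + j.val + 1 = 1 then (1 : L) else 0) v) : Subgroup (G2 × (cmDatum L 1 (Matrix.of fun i j : Fin 1 => if i.val + j.val + 1 = 1 then (1 : L) else 0)).Local v)) : Set (G2 × (cmDatum L 1 (Matrix.of fun i j : Fin 1 => if i.val + j.val + 1 = 1 then (1 : L) else 0)).Local v))) =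
        Subtype.val ⁻¹' ((((cmLocalIntegralLevel L 2 (Matrix.of fun i j : Fin 2 => if i.val + j.val + 1 = 2 then (1 : L) else 0) v).prod (cmLocalIntegralLevel L 1 (Matrix.of fun i j : Fin 1 => if i.val + j.val + 1 = 1 then (1 : L) else 0) v)) : Subgroup ((cmDatum L 2 (Matrix.of fun i j : Fin 2 => if i.val + j.val + 1 = 2 then (1 : L) else 0)).Local v × (cmDatum L 1 (Matrix.of fun i j : Fin 1 => if i.val + j.val + 1 = 1 then (1 : L) else 0)).Local v)) : Set ((cmDatum L 2 (Matrix.of fun i j : Fin 2 => if i.val + j.val + 1 = 2 then (1 : L) else 0)).Local v × (cmDatum L 1 (Matrix.of fun i j : Fin 1 => if i.val + j.val + 1 = 1 then (1 : L) else 0)).Local v)) := by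
      ext z
      simp only [Set.mem_preimage]
      exact (hK' (z : ((cmDatum L 2 (Matrix.of fun i j : Fin 2 => if i.val + j.val + 1 = 2 then (1 : L) else 0)).Local v × (cmDatum L 1 (Matrix.of fun i j : Fin 1 => if i.val + j.val + 1 = 1 then (1 : L) else 0)).Local v))).symm
    rw [hpre]
    exact measure_preimage_eq_one_of_compactCore_subset _ tZ htZ1 _ hKHco.1 hcore
  -- Step 5: the twist `J_H = χ⁻(b − 1)⁻¹` on `N₂ × 1` (★ A′ through ★ C′₁) and the transported descent (★ F0P3b-p01 FILE B §2)
  haveI : BorelSpace ↥(unipotentU (conjLocal L (IsCMField.complexConj L) v) (cmLocalForm L 2 v)) := Subtype.borelSpace _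
  have htT' : Ψ (γ₂, γ₁) ∈ (torusU (conjLocal L (IsCMField.complexConj L) v) (cmLocalForm L 2 v)).prod (⊤ : Subgroup ((cmDatum L 1 (Matrix.of fun i j : Fin 1 => if i.val + j.val + 1 = 1 then (1 : L) else 0)).Local v)) := (hZ _).2 ht₂
  have ht' : ∀ a ∈ (torusU (conjLocal L (IsCMField.complexConj L) v) (cmLocalForm L 2 v)).prod (⊤ : Subgroup ((cmDatum L 1 (Matrix.of fun i j : Fin 1 => if i.val + j.val + 1 = 1 then (1 : L) else 0)).Local v)), a * Ψ (γ₂, γ₁) = Ψ (γ₂, γ₁) * a := fun a ha =>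
    mul_comm_of_mem hZ (fun x hx y hy => mul_comm_of_mem_torusU_cmLocal_two L v hx hy) hU a ha _ htT'
  haveI : SecondCountableTopology (LocalRing L v) := secondCountableTopology_localRing (E := L) v
  letI : MeasurableSpace (LocalRing L v) := borel _
  haveI : BorelSpace (LocalRing L v) := ⟨rfl⟩
  have hJac : ∀ Φ : G2 × (cmDatum L 1 (Matrix.of fun i j : Fin 1 => if i.val + j.val + 1 = 1 then (1 : L) else 0)).Local v → ℝ≥0∞, Measurable Φ →
      ∫⁻ n, Φ ((n : G2 × (cmDatum L 1 (Matrix.of fun i j : Fin 1 => if i.val + j.val + 1 = 1 then (1 : L) else 0)).Local v) * Ψ (γ₂, γ₁) * (n : G2 × (cmDatum L 1 (Matrix.of fun i j : Fin 1 => if i.val + j.val + 1 = 1 then (1 : L) else 0)).Local v)⁻¹) ∂μN =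
        ((letI : MeasurableSpace (LocalRing L v) := borel _; haveI : BorelSpace (LocalRing L v) := ⟨rfl⟩
          haveI : SecondCountableTopology (LocalRing L v) := secondCountableTopology_localRing (E := L) v
          ((skewModulus (conjLocal L (IsCMField.complexConj L) v) (continuous_conjLocal L (IsCMField.complexConj L) v) hb.unit
            (map_unit_torusScalar_sub_one_two (conjLocal L (IsCMField.complexConj L) v) (cmLocalForm_eq_over L 2 v) (⟨t₂, ht₂⟩ : ↥(torusU (conjLocal L (IsCMField.complexConj L) v) (cmLocalForm L 2 v))) hdt hb))⁻¹ : ℝ≥0)) : ℝ≥0∞) *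
        ∫⁻ n, Φ (Ψ (γ₂, γ₁) * (n : G2 × (cmDatum L 1 (Matrix.of fun i j : Fin 1 => if i.val + j.val + 1 = 1 then (1 : L) else 0)).Local v)) ∂μN := by
    intro Φ hΦ
    have hΨγ : Ψ (γ₂, γ₁) = (t₂, γ₁) := rfl
    rw [hΨγ]
    exact lintegral_conj_prodBot_eq_mul t₂ γ₁ (fun μ₂ _ Φ₂ hΦ₂ =>
      lintegral_conj_eq_mul_lintegral_mul_two (conjLocal L (IsCMField.complexConj L) v) (continuous_conjLocal L (IsCMField.complexConj L) v)
        (cmLocalForm_eq_over L 2 v) μ₂ ht₂ hdt hb Φ₂ hΦ₂) μN Φ hΦ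
  have key := lintegral_descConj_centralizer_indicator_eq_of_mulEquiv (G := G2 × (cmDatum L 1 (Matrix.of fun i j : Fin 1 => if i.val + j.val + 1 = 1 then (1 : L) else 0)).Local v) hKco.2 hT hTN hKP ν tT κ μN Ψ hΨ hΨs
    (γ₂, γ₁) hZT νH hν tZ htT (((cmLocalIntegralLevel L 2 (Matrix.of fun i j : Fin 2 => if i.val + j.val + 1 = 2 then (1 : L) else 0) v).prod (cmLocalIntegralLevel L 1 (Matrix.of fun i j : Fin 1 => if i.val + j.val + 1 = 1 then (1 : L) else 0) v))) hK' hμC hν1 htK1 htT' ht' hJac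
  rw [key, Set.indicator_of_mem (show Ψ (γ₂, γ₁) ∈ ((K2.prod (cmLocalIntegralLevel L 1 (Matrix.of fun i j : Fin 1 => if i.val + j.val + 1 = 1 then (1 : L) else 0) v) : Subgroup (G2 × (cmDatum L 1 (Matrix.of fun i j : Fin 1 => if i.val + j.val + 1 = 1 then (1 : L) else 0)).Local v)) : Set (G2 × (cmDatum L 1 (Matrix.of fun i j : Fin 1 => if i.val + j.val + 1 = 1 then (1 : L) else 0)).Local v)) from (hK' _).1 hγH),
    Pi.one_apply, mul_one, ENNReal.coe_toReal, twistModule_cmLocal_two_eq L v ht₂ hdt hb]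

end Literature.NumberTheory.Automorphic.UnitaryGroup

end
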